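import Summits.ValiantsHypothesis.ValiantsHypothesis.Theses.SliceSignRank
import Summits.ValiantsHypothesis.ValiantsHypothesis.Theorems.SliceSignRankPositiveSliceNormalFormSummitHard

/-!
# Redirect of crux `SliceSignRank.PositiveSliceNormalForm` (stmt-ValiantsHypothesis-15119): the split assembly

The crux FNF⁺ = `PositiveSliceNormalForm` alone implies the summit
(`SliceSignRankPositiveSliceNormalForm.valiantsHypothesis_of_positiveSliceNormalForm`), so it is re-examined as
an ASSEMBLY node.  This file lands the kernel-checked assembly of its redirect into two pieces, stated here with
their bodies INLINED (the route file receives them as the child declarations `SrkNotQP` and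
`PositiveSliceSignTransfer` of the split; the types below are definitionally those bodies):

* **SRK∞** (`SrkNotQP`): the sign-rank with don't-cares of the Levi-Civita tensor is not quasi-polynomially
  bounded — for every `c` some `n ≥ 1` admits no real sign-representation of `sgn` on `S_n` of length
  `≤ 2^((log₂ n + c)^c)`.  The infinitely-often weakening of the sibling crux `SignRankSuperQP`
  (`srkNotQP_of_signRankSuperQP`) and exactly the sign-rank input the deciding argument consumes.
* **SGN-TRANSFER** (`PositiveSliceSignTransfer`): every positive-slice `VP` family yields, for all `n ≥ 1`, a
  quasi-polynomial-length real SIGN-representation of `sgn` on `S_n`.  Implied by FNF⁺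
  (`positiveSliceSignTransfer_of_positiveSliceNormalForm`: an exact representation of a positive coefficient
  function is a sign-representation) and, vacuously, by the target PPC
  (`positiveSliceSignTransfer_of_positivePatternHard`).

Assembly (trivial seam): the two pieces give PPC (`positivePatternHard_of_subs`), and FNF⁺ carries PPC's negation
among its hypotheses (`positiveSliceNormalForm_of_subs`); hence also the summit (`valiantsHypothesis_of_subs`).
Pure logic over the route's declarations; no named facts assumed.  References for the notions: Valiant, STOC 1979
(VP, VNP, PPC-type transfer); Forster, JCSS 65 (2002) 612–625 and Razborov–Sherstov, SIAM J. Comput. 39 (2010)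
1833–1855 (sign-rank); Alon–Moran–Yehudayoff, "Sign rank versus VC dimension", COLT 2016 (sign-rank with
don't-cares).
-/

-- single-conjunct layout: Sub = Summit, duplicated namespace component intended
set_option linter.dupNamespace false

namespace Summit.ValiantsHypothesis.ValiantsHypothesis.Theorems.SliceSignRankPositiveSliceNormalFormSplit

open Literature.Computability.AlgebraicComplexity
open Summit.ValiantsHypothesis.ValiantsHypothesis.Theses.SliceSignRank
open scoped BigOperators

/-- **SPLIT ASSEMBLY** (glue of the redirect `PositiveSliceNormalForm ⟸ SrkNotQP ∧ PositiveSliceSignTransfer`).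
SRK∞ and SGN-TRANSFER are contradictory on any positive-slice `VP` family, so FNF⁺ holds (vacuously in its
`IsVPFamily` hypothesis).  The two hypothesis types are, verbatim, the bodies of the split children. [folklore] -/
theorem positiveSliceNormalForm_of_subs
    (hS : ∀ c : ℕ, ∃ n : ℕ, 1 ≤ n ∧ ∀ k ≤ 2 ^ ((Nat.log 2 n + c) ^ c),
      ¬ ∃ W : Fin k → Matrix (Fin n) (Fin n) ℝ, ∀ σ : Equiv.Perm (Fin n),
        0 < ((Equiv.Perm.sign σ : ℤ) : ℝ) * ∑ t, ∏ i, W t (σ i) i)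
    (hT : ∀ f : (n : ℕ) → MvPolynomial (Fin n × Fin n) ℂ,
      (∀ (n : ℕ) (d : Fin n × Fin n →₀ ℕ), (∀ ρ : Equiv.Perm (Fin n), permMonomial ρ ≠ d) →
          MvPolynomial.coeff d (f n) = 0) →
      (∀ (n : ℕ) (ρ : Equiv.Perm (Fin n)), ∃ r : ℝ, 0 < r ∧
          MvPolynomial.coeff (permMonomial ρ) (f n) = (r : ℂ)) →
      IsVPFamily f →
      ∃ c : ℕ, ∀ n : ℕ, 1 ≤ n → ∃ k ≤ 2 ^ ((Nat.log 2 n + c) ^ c),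
        ∃ W : Fin k → Matrix (Fin n) (Fin n) ℝ, ∀ σ : Equiv.Perm (Fin n),
          0 < ((Equiv.Perm.sign σ : ℤ) : ℝ) * ∑ t, ∏ i, W t (σ i) i) :
    PositiveSliceNormalForm := by
  intro f h0 h1 hVP
  exfalso
  obtain ⟨c, hc⟩ := hT f h0 h1 hVP
  obtain ⟨n, hn1, hn⟩ := hS c
  obtain ⟨k, hk, W, hW⟩ := hc n hn1
  exact hn k hk ⟨W, hW⟩

/-- The two pieces give the route's target PPC (`PositivePatternHard`) directly. [folklore] -/
theorem positivePatternHard_of_subs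
    (hS : ∀ c : ℕ, ∃ n : ℕ, 1 ≤ n ∧ ∀ k ≤ 2 ^ ((Nat.log 2 n + c) ^ c),
      ¬ ∃ W : Fin k → Matrix (Fin n) (Fin n) ℝ, ∀ σ : Equiv.Perm (Fin n),
        0 < ((Equiv.Perm.sign σ : ℤ) : ℝ) * ∑ t, ∏ i, W t (σ i) i)
    (hT : ∀ f : (n : ℕ) → MvPolynomial (Fin n × Fin n) ℂ,
      (∀ (n : ℕ) (d : Fin n × Fin n →₀ ℕ), (∀ ρ : Equiv.Perm (Fin n), permMonomial ρ ≠ d) →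
          MvPolynomial.coeff d (f n) = 0) →
      (∀ (n : ℕ) (ρ : Equiv.Perm (Fin n)), ∃ r : ℝ, 0 < r ∧
          MvPolynomial.coeff (permMonomial ρ) (f n) = (r : ℂ)) →
      IsVPFamily f →
      ∃ c : ℕ, ∀ n : ℕ, 1 ≤ n → ∃ k ≤ 2 ^ ((Nat.log 2 n + c) ^ c),
        ∃ W : Fin k → Matrix (Fin n) (Fin n) ℝ, ∀ σ : Equiv.Perm (Fin n),
          0 < ((Equiv.Perm.sign σ : ℤ) : ℝ) * ∑ t, ∏ i, W t (σ i) i) :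
    PositivePatternHard := by
  intro f h0 h1 hVP
  obtain ⟨c, hc⟩ := hT f h0 h1 hVP
  obtain ⟨n, hn1, hn⟩ := hS c
  obtain ⟨k, hk, W, hW⟩ := hc n hn1
  exact hn k hk ⟨W, hW⟩

/-- Hence the two pieces decide the summit (through the landed `FNF⁺ → VH`). [folklore] -/
theorem valiantsHypothesis_of_subs
    (hS : ∀ c : ℕ, ∃ n : ℕ, 1 ≤ n ∧ ∀ k ≤ 2 ^ ((Nat.log 2 n + c) ^ c),
      ¬ ∃ W : Fin k → Matrix (Fin n) (Fin n) ℝ, ∀ σ : Equiv.Perm (Fin n),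
        0 < ((Equiv.Perm.sign σ : ℤ) : ℝ) * ∑ t, ∏ i, W t (σ i) i)
    (hT : ∀ f : (n : ℕ) → MvPolynomial (Fin n × Fin n) ℂ,
      (∀ (n : ℕ) (d : Fin n × Fin n →₀ ℕ), (∀ ρ : Equiv.Perm (Fin n), permMonomial ρ ≠ d) →
          MvPolynomial.coeff d (f n) = 0) →
      (∀ (n : ℕ) (ρ : Equiv.Perm (Fin n)), ∃ r : ℝ, 0 < r ∧
          MvPolynomial.coeff (permMonomial ρ) (f n) = (r : ℂ)) →
      IsVPFamily f →
      ∃ c : ℕ, ∀ n : ℕ, 1 ≤ n → ∃ k ≤ 2 ^ ((Nat.log 2 n + c) ^ c),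
        ∃ W : Fin k → Matrix (Fin n) (Fin n) ℝ, ∀ σ : Equiv.Perm (Fin n),
          0 < ((Equiv.Perm.sign σ : ℤ) : ℝ) * ∑ t, ∏ i, W t (σ i) i) :
    _root_.ValiantsHypothesis :=
  SliceSignRankPositiveSliceNormalForm.valiantsHypothesis_of_positiveSliceNormalForm
    (positiveSliceNormalForm_of_subs hS hT)

/-- SRK∞ is implied by the sibling crux SRK = `SignRankSuperQP` (almost-everywhere ⇒ infinitely often, at
`n = max n₀ 1`). [folklore] -/
theorem srkNotQP_of_signRankSuperQP (h : SignRankSuperQP) :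
    ∀ c : ℕ, ∃ n : ℕ, 1 ≤ n ∧ ∀ k ≤ 2 ^ ((Nat.log 2 n + c) ^ c),
      ¬ ∃ W : Fin k → Matrix (Fin n) (Fin n) ℝ, ∀ σ : Equiv.Perm (Fin n),
        0 < ((Equiv.Perm.sign σ : ℤ) : ℝ) * ∑ t, ∏ i, W t (σ i) i := by
  intro c
  obtain ⟨n₀, hn₀⟩ := h c
  exact ⟨max n₀ 1, le_max_right _ _, fun k hk => hn₀ (max n₀ 1) (le_max_left _ _) k hk⟩

/-- SGN-TRANSFER is implied by FNF⁺: an exact real representation of a positive coefficient function is a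
sign-representation of `sgn`. [folklore] -/
theorem positiveSliceSignTransfer_of_positiveSliceNormalForm (hF : PositiveSliceNormalForm) :
    ∀ f : (n : ℕ) → MvPolynomial (Fin n × Fin n) ℂ,
      (∀ (n : ℕ) (d : Fin n × Fin n →₀ ℕ), (∀ ρ : Equiv.Perm (Fin n), permMonomial ρ ≠ d) →
          MvPolynomial.coeff d (f n) = 0) →
      (∀ (n : ℕ) (ρ : Equiv.Perm (Fin n)), ∃ r : ℝ, 0 < r ∧
          MvPolynomial.coeff (permMonomial ρ) (f n) = (r : ℂ)) →
      IsVPFamily f →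
      ∃ c : ℕ, ∀ n : ℕ, 1 ≤ n → ∃ k ≤ 2 ^ ((Nat.log 2 n + c) ^ c),
        ∃ W : Fin k → Matrix (Fin n) (Fin n) ℝ, ∀ σ : Equiv.Perm (Fin n),
          0 < ((Equiv.Perm.sign σ : ℤ) : ℝ) * ∑ t, ∏ i, W t (σ i) i := by
  intro f h0 h1 hVP
  obtain ⟨c, hc⟩ := hF f h0 h1 hVP
  refine ⟨c, fun n hn => ?_⟩
  obtain ⟨k, hk, W, hW⟩ := hc n hn
  refine ⟨k, hk, W, fun σ => ?_⟩
  obtain ⟨r, hr, hrσ⟩ := h1 n σ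
  have h := hrσ.symm.trans (hW σ)
  have h' : r = ((Equiv.Perm.sign σ : ℤ) : ℝ) * ∑ t, ∏ i, W t (σ i) i := by
    apply Complex.ofReal_injective
    push_cast
    exact h
  rw [← h']
  exact hr

/-- SGN-TRANSFER is implied (vacuously) by the route's target PPC = `PositivePatternHard`; recorded for the
tribunal's dominating-hypothesis reading of the redirect.  Together with `positivePatternHard_of_subs`:
under SRK∞, SGN-TRANSFER ↔ PPC. [folklore] -/
theorem positiveSliceSignTransfer_of_positivePatternHard (hP : PositivePatternHard) :
    ∀ f : (n : ℕ) → MvPolynomial (Fin n × Fin n) ℂ,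
      (∀ (n : ℕ) (d : Fin n × Fin n →₀ ℕ), (∀ ρ : Equiv.Perm (Fin n), permMonomial ρ ≠ d) →
          MvPolynomial.coeff d (f n) = 0) →
      (∀ (n : ℕ) (ρ : Equiv.Perm (Fin n)), ∃ r : ℝ, 0 < r ∧
          MvPolynomial.coeff (permMonomial ρ) (f n) = (r : ℂ)) →
      IsVPFamily f →
      ∃ c : ℕ, ∀ n : ℕ, 1 ≤ n → ∃ k ≤ 2 ^ ((Nat.log 2 n + c) ^ c),
        ∃ W : Fin k → Matrix (Fin n) (Fin n) ℝ, ∀ σ : Equiv.Perm (Fin n),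
          0 < ((Equiv.Perm.sign σ : ℤ) : ℝ) * ∑ t, ∏ i, W t (σ i) i :=
  fun f h0 h1 hVP => absurd hVP (hP f h0 h1)

end Summit.ValiantsHypothesis.ValiantsHypothesis.Theorems.SliceSignRankPositiveSliceNormalFormSplit
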